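import Mathlib
import Summits.NavierStokesRegularity.NavierStokesRegularity.Theorems.TypeIQuarterGateScarEnvelopeTypeISatelliteTowerEnvelopeLeaves
import Summits.NavierStokesRegularity.NavierStokesRegularity.Theorems.TypeIQuarterGateScarEnvelopeTypeISatelliteTowerGalleryNormalForm

/-!
# Sketch (ns-idea-17 g3, lens «control») — the TERMINAL LAYER of an enveloped Albritton–Barker
object: a finite, exact, scale-critical functional on the (E1⁺) face of the kernel exclusions of
`ScarEnvelopeTypeI` (stmt-NavierStokesRegularity-23843)

NS regularity is NOT proved here; nothing below proves 23843, `¬ EnvelopedLeaf`, `¬ OneScarLeaf`,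
`TypeILiouvilleAB` or any Liouville theorem.  This file TYPES the objects of the crux idea
`terminal-layer` (0 `sorry`; the only proofs are logical glue):

* `HasFinalSlice U u₀` — the final slice (trace) `u₀(x) = lim_{t→0⁻} U(t,x)` off the origin;
* `TailFreezing` (support S1, provable-L: interior regularity at the envelope scale + Riesz pressure
  gradient decay): every enveloped A–B object has a final slice and
  `‖U(t,x) − u₀(x)‖ ≤ C(M,A)·(−t)/‖x‖³` for `‖x‖ ≥ √(−t)`;
* `RenormalisedEnergyIdentity` (support S2, provable-L: local energy EQUALITY of the smooth mild
  object + S1): `½∫(|U(t)|² − |u₀|²)dx = ∫_t^0 ∫ |∇U|² dx dτ` (both sides finite although neither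
  `U(t)` nor `u₀` is in `L²`);
* `layer U u₀ t = ∫ ‖U(t,x) − u₀(x)‖² dx` (in `ℝ≥0∞`) and the scale-critical LAYER FLOOR
  `LayerFloor` / its dichotomy-norm form `OneThinLayer` («ONE THIN LAYER ⇒ REGULAR ROOT»), the
  FIRST LEMMA of the line (provable-M/L: gallery compactness `abTower_galleryCompact`, envelope
  closedness `abTower_closed_decay`, persistence of the singular root, and the rigidity given by
  S2: zero layer at one scale ⇒ zero dissipation after it ⇒ `U ≡ 0` near the final time);
* `LayerCeiling` (support, from S1 + envelope);
* `LayerRelaxation` — the BET (transfer form `C⁺` of (E1⁺); OPEN, at least as hard as the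
  enveloped-DSS face): no enveloped A–B object keeps its layer floored at all scales;
* glue (kernel-checked): `oneThinLayer_iff_layerFloor`, `noEnvelopedLeaf_of_layerRelaxation`,
  `scarEnvelopeTypeI_of_layerRelaxation_noSelfDescending` (via the tree's PROVED
  `scarEnvelopeTypeI_of_noEnvelopedLeaf_noSelfDescending`).

SAME-WALL (WALL-BOARD-NS): hard core H3 (23843, (E1⁺) face); the floor is also a necessary
condition on every object of W7/H2 (10661 `TypeILiouvilleAB`) carrying an envelope.  Not W1.
-/

open MeasureTheory Set Metric Filter Topology
open scoped ENNReal

set_option linter.dupNamespace false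

namespace Summit.NavierStokesRegularity.NavierStokesRegularity.Cruxes.ScarEnvelopeTypeI.ZoomDictionary

namespace TerminalLayer

open Literature.Analysis.FluidPDE

/-! ## 0. Objects -/

/-- `u₀` is the FINAL SLICE (trace at the final time `0`) of the ancient field `U` off the origin:
`U(t,x) → u₀(x)` as `t → 0⁻` for every `x ≠ 0`.  The junk values `U 0 x` are never consulted. -/
def HasFinalSlice (U : ℝ → EuclideanSpace ℝ (Fin 3) → EuclideanSpace ℝ (Fin 3))
    (u₀ : EuclideanSpace ℝ (Fin 3) → EuclideanSpace ℝ (Fin 3)) : Prop :=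
  ∀ x : EuclideanSpace ℝ (Fin 3), x ≠ 0 → Tendsto (fun t : ℝ => U t x) (𝓝[<] (0 : ℝ)) (𝓝 (u₀ x))

/-- The (un-normalised) TERMINAL LAYER at time `t < 0`: the squared `L²(ℝ³)` distance of the live
slice `U(t)` to the final slice `u₀`, in `ℝ≥0∞` (no integrability is presupposed).  The
scale-critical layer is `layer / √(−t)`; it is invariant under the A–B scaling
`U ↦ ℓ U(ℓ² ·, ℓ ·)`. -/
noncomputable def layer (U : ℝ → EuclideanSpace ℝ (Fin 3) → EuclideanSpace ℝ (Fin 3))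
    (u₀ : EuclideanSpace ℝ (Fin 3) → EuclideanSpace ℝ (Fin 3)) (t : ℝ) : ℝ≥0∞ :=
  ∫⁻ x, ‖U t x - u₀ x‖ₑ ^ (2 : ℕ)

/-! ## 1. Support statements (provable from the mild formulation + the envelope; named, not proved) -/

/-- **S1 — TAIL FREEZING** (support, provable-L from tree assets).  Every A–B object of rate `M`
with the Type-I envelope `‖U(t,x)‖ ≤ A/(‖x‖ + √(−t))` has a final slice `u₀` off the origin, and
outside the parabolic core the live slices are already frozen onto it at the scale-invariant rate
`‖U(t,x) − u₀(x)‖ ≤ C·(−t)^{1−σ/2}/‖x‖^{3−σ}` (`‖x‖ ≥ √(−t)`) for some loss `0 ≤ σ < 1` (the truth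
is `σ = 0`; any `σ < 1` serves S2, the ceiling and the floor).  Mechanism: in profile variables
`(−t)^{3/2} ∂ₜU = ΔV − V·∇V − ∇Q` although `∂ₛV`, `½V`, `½y·∇V` are each only `O(1/(1+|y|))`;
the right side is `O((1+|y|)^{−3+σ})` by the tree's PROVED Pineau–Vicol (8.3) bounds for the class
`IsTypeIAncientMild C ∧ HasTypeIDecay C`
(`IsTypeIAncientMild.exists_forall_le_pow_mul_norm_iteratedFDeriv_lerayOrbit_of_hasTypeIDecay`,
orders `j ≤ 2`) and for the Calderón–Zygmund pressure
(`exists_bound_norm_iteratedFDeriv_pressurePotential_decay`, `k = 1`); integrate `∂ₜU` on `(t,0)`.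
USES THE EQUATION (mild representation ⇒ differentiated profile equation with `Q = RᵢRⱼ(VᵢVⱼ)`),
not only the local energy inequality. -/
def TailFreezing : Prop :=
  ∀ M A : ℝ, ∃ C σ : ℝ, 0 ≤ σ ∧ σ < 1 ∧ ∀ (U : ℝ → EuclideanSpace ℝ (Fin 3) → EuclideanSpace ℝ (Fin 3))
    (P : ℝ → EuclideanSpace ℝ (Fin 3) → ℝ)
    (H : ℝ → EuclideanSpace ℝ (Fin 3) → EuclideanSpace ℝ (Fin 3) →L[ℝ] EuclideanSpace ℝ (Fin 3)),
    ABTower M U P H → HasTypeIDecay A U →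
      ∃ u₀ : EuclideanSpace ℝ (Fin 3) → EuclideanSpace ℝ (Fin 3), HasFinalSlice U u₀ ∧
        ∀ t : ℝ, t < 0 → ∀ x : EuclideanSpace ℝ (Fin 3), Real.sqrt (-t) ≤ ‖x‖ →
          ‖U t x - u₀ x‖ ≤ C * (-t) ^ (1 - σ / 2) / ‖x‖ ^ (3 - σ)

/-- **S2 — RENORMALISED ENERGY IDENTITY** (support, provable-L).  For an enveloped A–B object with
final slice `u₀`: the energy drop to the final time is finite and equals the dissipation still to
be paid, `∫ (|U(t,x)|² − |u₀(x)|²) dx = 2 ∫_t^0 ∫ |∇U(τ,x)|² dx dτ` for every `t < 0` — although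
neither `U(t)` nor `u₀ ∼ a(x̂)/‖x‖` is square integrable (the difference is `O((−t)/‖x‖⁴)` at
infinity by S1 and `O(A²/‖x‖²)` at the origin).  Local energy EQUALITY of the smooth mild object on
`(t, −δ) × B_R`, flux `O(1/R)`, then `δ → 0` by dominated convergence.  `H` is the weak spatial
gradient carried by `ABTower`; `frobeniusNormSq (H τ x) = |∇U(τ,x)|²`. -/
def RenormalisedEnergyIdentity : Prop :=
  ∀ (M A : ℝ) (U : ℝ → EuclideanSpace ℝ (Fin 3) → EuclideanSpace ℝ (Fin 3))
    (P : ℝ → EuclideanSpace ℝ (Fin 3) → ℝ)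
    (H : ℝ → EuclideanSpace ℝ (Fin 3) → EuclideanSpace ℝ (Fin 3) →L[ℝ] EuclideanSpace ℝ (Fin 3))
    (u₀ : EuclideanSpace ℝ (Fin 3) → EuclideanSpace ℝ (Fin 3)),
    ABTower M U P H → HasTypeIDecay A U → HasFinalSlice U u₀ →
      ∀ t : ℝ, t < 0 →
        Integrable (fun x => ‖U t x‖ ^ (2 : ℕ) - ‖u₀ x‖ ^ (2 : ℕ)) ∧
        ∫ x, (‖U t x‖ ^ (2 : ℕ) - ‖u₀ x‖ ^ (2 : ℕ)) =
          2 * ∫ τ in Ioo t 0, ∫ x, frobeniusNormSq (H τ x)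

/-- **LAYER CEILING** (support, from S1 + the envelope): `layer(t) ≤ C(M,A) √(−t)` — the core
`‖x‖ ≤ √(−t)` contributes `O(A² √(−t))` and the frozen tails `O(C² √(−t))`. -/
def LayerCeiling : Prop :=
  ∀ M A : ℝ, ∃ C : ℝ, ∀ (U : ℝ → EuclideanSpace ℝ (Fin 3) → EuclideanSpace ℝ (Fin 3))
    (P : ℝ → EuclideanSpace ℝ (Fin 3) → ℝ)
    (H : ℝ → EuclideanSpace ℝ (Fin 3) → EuclideanSpace ℝ (Fin 3) →L[ℝ] EuclideanSpace ℝ (Fin 3))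
    (u₀ : EuclideanSpace ℝ (Fin 3) → EuclideanSpace ℝ (Fin 3)),
    ABTower M U P H → HasTypeIDecay A U → HasFinalSlice U u₀ →
      ∀ t : ℝ, t < 0 → layer U u₀ t ≤ ENNReal.ofReal (C * Real.sqrt (-t))

/-! ## 2. The first lemma of the line: the LAYER FLOOR and its dichotomy-norm form -/

/-- **K0 — LAYER FLOOR** (first lemma; provable-M/L).  For each rate `M` and envelope constant
`A` there is `η(M,A) > 0` such that every enveloped A–B object which is SINGULAR at the final-time
origin keeps its live slices at scale-critical `L²`-distance at least `η √(−t)` from its own final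
slice, at EVERY time `t < 0`: the live parabolic core never freezes early onto the trace.
Proof sketch: normalise `t = −1` by scaling; a violating sequence has a gallery limit
(`abTower_galleryCompact`) which is again enveloped (`abTower_closed_decay`) and singular at the
root (persistence of singularities), and whose layer at `t = −1` VANISHES (the layer is continuous
under gallery convergence: local uniform convergence for `t ≤ −δ`, traces converge locally
uniformly off the origin by S1, dominated tails); by S2 its dissipation on `(−1,0)` vanishes, so it
is spatially constant, hence `0` by the envelope — a regular root: contradiction.  The rigidity
step is the energy IDENTITY (no Tsai / NRŠ profile Liouville is used). -/
def LayerFloor : Prop :=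
  ∀ M A : ℝ, ∃ η : ℝ, 0 < η ∧ ∀ (U : ℝ → EuclideanSpace ℝ (Fin 3) → EuclideanSpace ℝ (Fin 3))
    (P : ℝ → EuclideanSpace ℝ (Fin 3) → ℝ)
    (H : ℝ → EuclideanSpace ℝ (Fin 3) → EuclideanSpace ℝ (Fin 3) →L[ℝ] EuclideanSpace ℝ (Fin 3))
    (u₀ : EuclideanSpace ℝ (Fin 3) → EuclideanSpace ℝ (Fin 3)),
    ABTower M U P H → HasTypeIDecay A U → ¬ RegPt U 0 → HasFinalSlice U u₀ →
      ∀ t : ℝ, t < 0 → ENNReal.ofReal (η * Real.sqrt (-t)) ≤ layer U u₀ t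

/-- **K0′ — ONE THIN LAYER ⇒ REGULAR ROOT** (the dichotomy-norm form of the floor, lens
«control»): an enveloped A–B object whose live slice at ONE time `t < 0` is `η(M,A)√(−t)`-close
in `L²` to its final slice is regular at the final-time origin. -/
def OneThinLayer : Prop :=
  ∀ M A : ℝ, ∃ η : ℝ, 0 < η ∧ ∀ (U : ℝ → EuclideanSpace ℝ (Fin 3) → EuclideanSpace ℝ (Fin 3))
    (P : ℝ → EuclideanSpace ℝ (Fin 3) → ℝ)
    (H : ℝ → EuclideanSpace ℝ (Fin 3) → EuclideanSpace ℝ (Fin 3) →L[ℝ] EuclideanSpace ℝ (Fin 3))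
    (u₀ : EuclideanSpace ℝ (Fin 3) → EuclideanSpace ℝ (Fin 3)),
    ABTower M U P H → HasTypeIDecay A U → HasFinalSlice U u₀ →
      (∃ t : ℝ, t < 0 ∧ layer U u₀ t < ENNReal.ofReal (η * Real.sqrt (-t))) → RegPt U 0

/-- The two forms are the same statement (contraposition). -/
theorem oneThinLayer_iff_layerFloor : OneThinLayer ↔ LayerFloor := by
  constructor
  · intro h M A
    obtain ⟨η, hη, hreg⟩ := h M A
    refine ⟨η, hη, fun U P H u₀ hAB hdec hsing hfs t ht => ?_⟩
    by_contra hlt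
    exact hsing (hreg U P H u₀ hAB hdec hfs ⟨t, ht, lt_of_not_ge hlt⟩)
  · intro h M A
    obtain ⟨η, hη, hfloor⟩ := h M A
    refine ⟨η, hη, fun U P H u₀ hAB hdec hfs ⟨t, ht, hlt⟩ => ?_⟩
    by_contra hsing
    exact absurd (hfloor U P H u₀ hAB hdec hsing hfs t ht) (not_le.mpr hlt)

/-! ## 3. The bet (transfer form of (E1⁺)) and the kernel-checked glue -/

/-- **THE BET — LAYER RELAXATION** (OPEN; the transfer form `C⁺` of the exclusion (E1⁺); at least
as hard as the enveloped-DSS face, on which the scale-critical layer is periodic in `log(−t)`):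
along every enveloped A–B object the scale-critical layer is not floored — for every `η > 0` some
live slice is `η√(−t)`-close to the final slice.  Exact laws available to attack it (profile
variables `s = −log(−t)`, `V`, `V₀^{(s)}(y) = e^{−s/2}u₀(e^{−s/2}y)`, `W = V − V₀^{(s)}`,
`𝔴 = ‖W‖²`, `𝓂 = ½∫(|V|²−|V₀|²)`, `𝓀 = ⟨V₀, W⟩`, `𝒟 = ‖∇V‖²`, `𝒮V = ΔV − V·∇V − ∇Q` the
self-similar residual): `d𝓂/ds = ½𝓂 − 𝒟`, `d𝓀/ds = ½𝓀 + ⟨V₀^{(s)}, 𝒮V⟩`,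
`d𝔴/ds = ½𝔴 − 2𝒟 − 2⟨V₀^{(s)}, 𝒮V⟩`, with `𝔴, 𝓂, 𝓀` bounded on the enemy. -/
def LayerRelaxation : Prop :=
  ∀ (M A : ℝ) (U : ℝ → EuclideanSpace ℝ (Fin 3) → EuclideanSpace ℝ (Fin 3))
    (P : ℝ → EuclideanSpace ℝ (Fin 3) → ℝ)
    (H : ℝ → EuclideanSpace ℝ (Fin 3) → EuclideanSpace ℝ (Fin 3) →L[ℝ] EuclideanSpace ℝ (Fin 3))
    (u₀ : EuclideanSpace ℝ (Fin 3) → EuclideanSpace ℝ (Fin 3)),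
    ABTower M U P H → HasTypeIDecay A U → HasFinalSlice U u₀ →
      ∀ η : ℝ, 0 < η → ∃ t : ℝ, t < 0 ∧ layer U u₀ t < ENNReal.ofReal (η * Real.sqrt (-t))

/-- **Glue 1.** Tail freezing (existence of the final slice) + the dichotomy norm + the bet exclude
every enveloped leaf: (E1⁺). -/
theorem noEnvelopedLeaf_of_layerRelaxation (hS1 : TailFreezing) (hK0 : OneThinLayer)
    (hbet : LayerRelaxation) : ∀ M A : ℝ, ¬ EnvelopedLeaf M A := by
  intro M A hleaf
  obtain ⟨U, P, H, hAB, hdec, hsing⟩ := hleaf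
  obtain ⟨C, σ, -, -, hC⟩ := hS1 M A
  obtain ⟨u₀, hfs, -⟩ := hC U P H hAB hdec
  obtain ⟨η, hη, hreg⟩ := hK0 M A
  obtain ⟨t, ht, hlt⟩ := hbet M A U P H u₀ hAB hdec hfs η hη
  exact hsing (hreg U P H u₀ hAB hdec hfs ⟨t, ht, hlt⟩)

/-- **Glue 2 (reaches the crux by name).** With the tree's PROVED kernel reduction
`scarEnvelopeTypeI_of_noEnvelopedLeaf_noSelfDescending` (p653175): the terminal-layer package on
the (E1⁺) face plus the exclusion of a self-descending node (the H₂ face, untouched here) give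
23843. -/
theorem scarEnvelopeTypeI_of_layerRelaxation_noSelfDescending (hS1 : TailFreezing)
    (hK0 : OneThinLayer) (hbet : LayerRelaxation)
    (hS : ∀ (M : ℝ) (n : TNode), RootObj M n → ¬ TameRoot n → ¬ RootDescends n n) :
    Summit.NavierStokesRegularity.NavierStokesRegularity.Theses.TypeIQuarterGate.ScarEnvelopeTypeI :=
  scarEnvelopeTypeI_of_noEnvelopedLeaf_noSelfDescending
    (noEnvelopedLeaf_of_layerRelaxation hS1 hK0 hbet) hS

/-- **Placement (⟸ H2).** The bet is implied by `TypeILiouvilleAB` restricted to enveloped objects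
together with the (provable) relaxation of the layer at REGULAR roots — recorded as the statement
`RegularRootRelaxes` so that the logical position of the bet is explicit:
`TypeILiouvilleAB → RegularRootRelaxes → LayerRelaxation`. -/
def RegularRootRelaxes : Prop :=
  ∀ (M A : ℝ) (U : ℝ → EuclideanSpace ℝ (Fin 3) → EuclideanSpace ℝ (Fin 3))
    (P : ℝ → EuclideanSpace ℝ (Fin 3) → ℝ)
    (H : ℝ → EuclideanSpace ℝ (Fin 3) → EuclideanSpace ℝ (Fin 3) →L[ℝ] EuclideanSpace ℝ (Fin 3))
    (u₀ : EuclideanSpace ℝ (Fin 3) → EuclideanSpace ℝ (Fin 3)),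
    ABTower M U P H → HasTypeIDecay A U → HasFinalSlice U u₀ → RegPt U 0 →
      ∀ η : ℝ, 0 < η → ∃ t : ℝ, t < 0 ∧ layer U u₀ t < ENNReal.ofReal (η * Real.sqrt (-t))

theorem layerRelaxation_of_typeILiouvilleAB (hL : TypeILiouvilleAB) (hR : RegularRootRelaxes) :
    LayerRelaxation := by
  intro M A U P H u₀ hAB hdec hfs η hη
  exact hR M A U P H u₀ hAB hdec hfs (hL M U P H hAB) η hη

/-- Conversely the floor and the bet together say exactly that enveloped A–B objects are regular at
the root (given final slices exist): the bet is (E1⁺) in layer currency, not a weakening of it. -/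
theorem layerRelaxation_iff_noSingularEnveloped (hS1 : TailFreezing) (hK0 : LayerFloor)
    (hR : RegularRootRelaxes) :
    LayerRelaxation ↔
      ∀ (M A : ℝ) (U : ℝ → EuclideanSpace ℝ (Fin 3) → EuclideanSpace ℝ (Fin 3))
        (P : ℝ → EuclideanSpace ℝ (Fin 3) → ℝ)
        (H : ℝ → EuclideanSpace ℝ (Fin 3) → EuclideanSpace ℝ (Fin 3) →L[ℝ] EuclideanSpace ℝ (Fin 3)),
        ABTower M U P H → HasTypeIDecay A U → RegPt U 0 := by
  constructor
  · intro hbet M A U P H hAB hdec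
    have hK0' : OneThinLayer := oneThinLayer_iff_layerFloor.mpr hK0
    by_contra hsing
    exact noEnvelopedLeaf_of_layerRelaxation hS1 hK0' hbet M A ⟨U, P, H, hAB, hdec, hsing⟩
  · intro hreg M A U P H u₀ hAB hdec hfs η hη
    exact hR M A U P H u₀ hAB hdec hfs (hreg M A U P H hAB hdec) η hη

end TerminalLayer

end Summit.NavierStokesRegularity.NavierStokesRegularity.Cruxes.ScarEnvelopeTypeI.ZoomDictionary
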